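/-
Copyright: public-domain mathematics; typed transcription for the H21 Literature library (cell lit-balaban,
reader/typer seat r02 gen 5 = literature-prover-lit-balaban-r02-g5-0).

statement-level skeleton of published theorems with citation tags; proofs where landed; nothing here is a claim about the Yang–Mills mass gap

# Bałaban, *Propagators and renormalization transformations for lattice gauge theories. I*,
# Commun. Math. Phys. **95** (1984) 17–40 — the step (1.126) ⟹ (1.128) p. 38 for the partition of unity (1.118)
# WITH THE PRINTED PROFILE (`B5Partition118Printed`): the field `h128` of `B5Local114.Realisation`

[cite: Balaban1984PropagatorsI]  T. Bałaban, Commun. Math. Phys. 95 (1984) 17–40, p. 38 (PDF p. 22), verbatim (OCR layer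
of the held scan `paper:balaban1984-cmp95-propagators-rt-i` p0022.txt; the same sentences are quoted in the headers of
`B5Local114`, `B5Commutator128`, `B5Realisation128`):

  "Next we have to estimate |h_z K(h_z)A|. The operator K(h) is a simple, short-ranged, first order differential
  operator, except the term P₁(∂h)J. … This implies a bound on the operator h_{z₁}K(h_{z₂}). We have to consider
  separately the cases when □_{z₁}, □_{z₂} are disjoint, and when they are overlapping. In the first case we have only
  the operator h_{z₁}P₁(∂h_{z₂}) and (1.126) gives a bound with a small factor O(M₀⁻¹) and the exponential factor … In
  the second case we have the small factor O(M₀⁻¹) only … Defining 2δ₀ = min{⅓δ′₀, M₀⁻¹}, we obtain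
  |h_{z₁}K(h_{z₂})A| ≤ O(M₀⁻¹) e^{−2δ₀|z₁−z₂|} (|∇A| + |A|).  (1.128)"

WHAT THIS MODULE IS (SKELETON rows B5.Eq1.119 / B5.Eq1.128; companion of `B5Partition118Printed`, p253054).  The tree
proves (1.126) ⟹ (1.128) on the finite-torus model through a GENERIC schema (`B5Commutator128.h128_schema`: profiles
bounded by 1, supported in `s`-balls, `ℓ`-Lipschitz; a local part with a normed commutator bound `ℓ₁`; a kernel part
with the decay (1.126)) instantiated so far ONLY for the `C^{1,1}` no-plateau profile `B5SmoothPartition.HSop`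
(chain `B5SmoothPartition.h128S_torus` → `B5Leibniz121.h128_lap_torus` → `B5Averaging120.h128_finiteRange_torus` /
`h128_gram_torus` → `B5AveragingTorus.h128_balaban_torus` → `B5Realisation128.h128Shape_torus`).  THIS FILE runs the
same chain for the PRINTED partition `B5Partition118Printed.Hop118` (profile `h = B4PartitionUnity22.hprof`,
`h ∈ C₀^∞(]−⅔,⅔[)`, plateau `[−⅓,⅓]`, `Σ_n h²(t − n) = 1`), supplying the two profile data the schema consumes:

§1 `∇h_z = O(M₀⁻¹)` AS A GLOBAL LIPSCHITZ BOUND.  The periodised profile `hper P` is `sup|h′|`-Lipschitz on all of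
`ℝ` (`abs_hper_sub_le`: local charts of half-width ⅜ from `B5Partition118Printed.hper_local`, chained by the
elementary `lipschitz_of_local`); in circular terms `|hper P (a′/M₀ − z) − hper P (a/M₀ − z)| ≤ (sup|h′|/M₀)·dist(a′ − a, Nℤ)`
(`abs_hper_coord_sub_le`, `N = M₀P`); hence **`|h_z(x) − h_z(x′)| ≤ (d·sup|h′|/M₀)·dist_∞(x, x′)`** on the torus
(`abs_hz118_sub_le`, `hz118U_lipschitz`) — for EVERY `M₀ ≥ 1`.

§2 `Δh_z = O(M₀⁻²)` ALONG THE AXES: `|h_z(x + e_μ) − 2h_z(x) + h_z(x − e_μ)| ≤ sup|h″|/M₀²` on the carrier `UT N`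
(`abs_hz118U_centred_le`, `M₀ ≥ 3`; the lift bookkeeping `x ± e_μ` ↔ `val ± 1 mod N` over
`B5Partition118Printed.hz118_eq_hzR_of_lift`).

§3 THE CHAIN: `h128P_torus` (the schema with `a z i := h_z(π i)`, support radius `⅔M₀`, Lipschitz constant
`d·sup|h′|/M₀`), `h128P_torus_fibre`; the Laplacian part of (1.121) `local_norm_lap_h118`
(`ℓ₁ = (d·sup|h′|/M₀)√(2d) + d·sup|h″|/M₀²`); `h128_lap_torus118`; the finite-range (`aQ*Q`, `S(∂h)`) part
`local_finiteRange_h118'`, `h128_finiteRange_torus118`, `h128_gram_torus118`; Bałaban's `Q_k` on vector fields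
`h128_balaban_torus118`; and the packaging as the field: **`h128Shape_torus118 : B5Realisation128.H128Shape
(kernelData N k) M₀ (thetaBar128P d M₀ n a) (Hop118 N M₀ π₁) (deltaA n a k) Dg (ctrU N M₀)`** — (1.126) for `k` with
ANY constants `δ₀′, C > 0` implies (1.128) with `θ̄(δ₀′, C)/M₀` and `2δ₀ = twoDelta0 δ₀′ M₀`, uniformly in the volume.
Together with `B5Partition118Printed.h118_printed` / `symmH_printed` / `Hop118_eq_zero_of_supp` the PRINTED partition
now supplies every partition-dependent field of `B5Local114.Realisation` on the torus model.

HYPOTHESES, EXPLICIT.  `N_i = M₀·(N_i/M₀)` with `≥ 2` cubes per direction (the printed sublattice `T^{(k+m₀)}_{M₀}`);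
`M₀ ≥ 3` wherever second differences enter (print: M₀ "sufficiently large", p. 39); the remaining structural
hypotheses are those of `B5AveragingTorus.h128_balaban_torus` verbatim (`1 ≤ n`, `1 ≤ N_i/n`, a gradient operator
`Dg` dominating `√(dirichlet axisWC ·)`).  The decay (1.126) of `k` is the HYPOTHESIS of the predicate (B4 territory,
proved for the torus presentation elsewhere: `B5Kernel126TorusInstance`), exactly as in `B5Realisation128`.

HONEST LABELLING.  Everything here is kernel-proved and elementary given the cited tree modules; the only claims
attributed to the paper are the quoted sentences, (1.128), and the sizes `O(M₀⁻¹)`/`O(M₀⁻²)` of `∂h_z`/`Δh_z`.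
Imports: `B5Partition118Printed` (p253054), `B5Realisation128` (hence `B5AveragingTorus`, `B5Averaging120`,
`B5Leibniz121`, `B5Commutator128`, `B5SmoothPartition`, `B5Local114`, `B5Walk131`, `B5TorusCover`), Mathlib.
value = the located leaf `h128` of the L² walk (1.123)–(1.131) for the printed partition of unity — NOT summit progress.
-/
import Mathlib
import Literature.MathematicalPhysics.QuantumFieldTheory.Balaban1983to89.B5Partition118Printed
import Literature.MathematicalPhysics.QuantumFieldTheory.Balaban1983to89.B5Realisation128

open Finset

namespace Literature.MathematicalPhysics.QuantumFieldTheory.Balaban1983to89.B5Partition118H128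

open B4PartitionUnity22 (hprof D1 D2 D1_nonneg D2_nonneg contDiff_hprof hasCompactSupport_hprof abs_sub_le_D1)
open B4TorusKernel.MultiPeriod (circAbs circAbs_nonneg circAbs_le_abs circAbs_add_mul abs_add_mul_centre centre)
open B4Sect5Torus (TSite ccoord tdist circAbs_le_tdist ccoord_cast)
open B5TorusCover (nC one_le_nC Ctr ctr ctr_val UT ctrU)
open B5TorusPartition (mulOp mulOp_apply norm_mulOp_le abs_prod_sub_prod_le)
open B5Commutator128 (kerOp Schema h128_schema rowsum_fibre_le)
open B5Leibniz121 (lapKer dirichlet IsAxisLap up dn dist_up_le dist_dn_le norm_comm_lap_le' comm_kerOp_add axisWC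
  isAxisLap_prod)
open B5Averaging120 (gram120 norm_comm_finiteRange_le gram120_eq_zero_of_far smul_gram120_rowsum_le
  smul_gram120_colsum_le)
open B5AveragingTorus (avgKer fibre_card_fst dist_le_of_avgKer_ne_zero avgKer_colsum_le avgKer_abs_rowsum_le)
open B5SmoothPartition (fin_val_add_one_rep)
open B5Realisation128 (H128Shape kernelData deltaA)
open B5Local114 (Kop)
open B5Walk131 (twoDelta0)
open B5Partition118Printed (hper hper_nonneg hper_le_one hper_local hper_add_int_mul hzR hz118 hz118U Hop118
  hz118_nonneg hz118_le_one hz118_eq_zero_of_le hz118_eq_hzR_of_lift abs_hz118_lift_second_diff_le)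

noncomputable section

/-! ## §1  `∇h_z = O(M₀⁻¹)` as a global Lipschitz bound -/

section Lipschitz

/-- a function which is `L`-Lipschitz on every window of width `r > 0` is `L`-Lipschitz (chain the windows).
(plumbing of the printed torus partition) [cite: Balaban1984PropagatorsI, (1.118) p.36] -/
theorem lipschitz_of_local {g : ℝ → ℝ} {L r : ℝ} (hr : 0 < r)
    (h : ∀ u v : ℝ, |v - u| ≤ r → |g v - g u| ≤ L * |v - u|) (u v : ℝ) : |g v - g u| ≤ L * |v - u| := by
  have key : ∀ n : ℕ, ∀ u v : ℝ, |v - u| ≤ n * r → |g v - g u| ≤ L * |v - u| := by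
    intro n
    induction n with
    | zero =>
      intro u v huv
      have h0 : |v - u| ≤ 0 := by simpa using huv
      have h1 : v - u = 0 := abs_eq_zero.mp (le_antisymm h0 (abs_nonneg _))
      have h2 : v = u := sub_eq_zero.mp h1
      subst h2
      simp
    | succ n ih =>
      intro u v huv
      push_cast at huv
      have hn1 : (0 : ℝ) < n + 1 := by positivity
      set w := u + (n : ℝ) / (n + 1) * (v - u) with hw
      have e1 : v - w = (1 / ((n : ℝ) + 1)) * (v - u) := by
        rw [hw]; field_simp; ring
      have e2 : w - u = ((n : ℝ) / (n + 1)) * (v - u) := by rw [hw]; ring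
      have hvw : |v - w| ≤ r := by
        rw [e1, abs_mul, abs_of_nonneg (by positivity)]
        calc 1 / ((n : ℝ) + 1) * |v - u| ≤ 1 / ((n : ℝ) + 1) * ((n + 1) * r) :=
              mul_le_mul_of_nonneg_left huv (by positivity)
          _ = r := by field_simp
      have hwu : |w - u| ≤ n * r := by
        rw [e2, abs_mul, abs_of_nonneg (by positivity)]
        calc (n : ℝ) / (n + 1) * |v - u| ≤ (n : ℝ) / (n + 1) * ((n + 1) * r) :=
              mul_le_mul_of_nonneg_left huv (by positivity)
          _ = n * r := by field_simp
      have hsplit : |v - w| + |w - u| = |v - u| := by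
        rw [e1, e2, abs_mul, abs_mul, abs_of_nonneg (by positivity : (0 : ℝ) ≤ 1 / ((n : ℝ) + 1)),
          abs_of_nonneg (by positivity : (0 : ℝ) ≤ (n : ℝ) / (n + 1)), ← add_mul]
        have : (1 : ℝ) / (n + 1) + n / (n + 1) = 1 := by
          rw [← add_div, show (1 : ℝ) + n = n + 1 by ring]
          exact div_self hn1.ne'
        rw [this, one_mul]
      calc |g v - g u| = |(g v - g w) + (g w - g u)| := by ring_nf
        _ ≤ |g v - g w| + |g w - g u| := abs_add_le _ _
        _ ≤ L * |v - w| + L * |w - u| := add_le_add (h w v hvw) (ih u w hwu)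
        _ = L * |v - u| := by rw [← mul_add, hsplit]
  obtain ⟨n, hn⟩ : ∃ n : ℕ, |v - u| ≤ n * r := by
    obtain ⟨n, hn⟩ := exists_nat_ge (|v - u| / r)
    exact ⟨n, by rwa [div_le_iff₀ hr] at hn⟩
  exact key n u v hn

/-- **the periodised printed profile is globally `sup|h′|`-Lipschitz** (`P ≥ 2`): `|hper P v − hper P u| ≤ sup|h′|·|v − u|`
— `∂h = O(1)` in profile units (our shorthand; v1.1: it stood inside guillemets, QUOTE-AUDIT-B5 §G G2), the datum behind
«the small factor O(M₀⁻¹)» of p. 38.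
[cite: Balaban1984PropagatorsI, (1.118) p.36 with (1.128) p.38] -/
theorem abs_hper_sub_le {P : ℕ} (hP : 2 ≤ P) (u v : ℝ) : |hper P v - hper P u| ≤ D1 hprof * |v - u| := by
  refine lipschitz_of_local (by norm_num : (0 : ℝ) < 3 / 8) ?_ u v
  intro u v huv
  obtain ⟨m, hm⟩ := hper_local hP u
  rw [hm v huv, hm u (by rw [sub_self, abs_zero]; norm_num)]
  have h := abs_sub_le_D1 contDiff_hprof hasCompactSupport_hprof (u - m * P) (v - m * P)
  rwa [show v - (m : ℝ) * P - (u - m * P) = v - u by ring] at h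

/-- **`∇h_z = O(M₀⁻¹)` per coordinate, in circular terms**: for integers `a, a′`, `N = M₀·P` (`P ≥ 2`, `M₀ ≥ 1`) and any
centre offset `z`, `|hper P (a′/M₀ − z) − hper P (a/M₀ − z)| ≤ (sup|h′|/M₀)·dist(a′ − a, Nℤ)`.
[cite: Balaban1984PropagatorsI, (1.118) p.36 with (1.128) p.38] -/
theorem abs_hper_coord_sub_le {M₀ P : ℕ} (hM : 1 ≤ M₀) (hP : 2 ≤ P) (z : ℝ) (a a' : ℤ) :
    |hper P ((a' : ℝ) / M₀ - z) - hper P ((a : ℝ) / M₀ - z)|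
      ≤ D1 hprof / M₀ * (circAbs (M₀ * P) (a' - a) : ℝ) := by
  have hM0 : (0 : ℝ) < M₀ := by exact_mod_cast hM
  have hN : 1 ≤ M₀ * P := Nat.one_le_iff_ne_zero.mpr (Nat.mul_ne_zero (by omega) (by omega))
  set r : ℤ := (a' - a) + ((M₀ * P : ℕ) : ℤ) * centre (M₀ * P) (a' - a) with hr
  have hrabs : |r| = circAbs (M₀ * P) (a' - a) := abs_add_mul_centre hN _
  have ha' : (a' : ℝ) / M₀ - z
      = (((a : ℝ) + r) / M₀ - z) + ((-(centre (M₀ * P) (a' - a)) : ℤ) : ℝ) * (P : ℝ) := by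
    rw [hr]
    push_cast
    field_simp
    ring
  rw [ha', hper_add_int_mul (by omega : 1 ≤ P)]
  calc |hper P (((a : ℝ) + r) / M₀ - z) - hper P ((a : ℝ) / M₀ - z)|
      ≤ D1 hprof * |(((a : ℝ) + r) / M₀ - z) - ((a : ℝ) / M₀ - z)| := abs_hper_sub_le hP _ _
    _ = D1 hprof / M₀ * |(r : ℝ)| := by
        rw [show ((a : ℝ) + r) / M₀ - z - ((a : ℝ) / M₀ - z) = (r : ℝ) / M₀ by ring, abs_div, abs_of_pos hM0]
        ring
    _ = D1 hprof / M₀ * (circAbs (M₀ * P) (a' - a) : ℝ) := by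
        rw [← Int.cast_abs, hrabs]

variable {d : ℕ} {N : Fin d → ℕ}

/-- **`|h_z(x) − h_z(x′)| ≤ (d·sup|h′|/M₀)·dist_∞(x, x′)` on the torus** (every `M₀ ≥ 1`, `N_i = M₀·(N_i/M₀)`, `≥ 2`
cubes per direction): the printed partition functions are `O(M₀⁻¹)`-Lipschitz in the sup circular distance.
[cite: Balaban1984PropagatorsI, (1.118) p.36 with (1.128) p.38] -/
theorem abs_hz118_sub_le {M₀ : ℕ} (hM : 1 ≤ M₀) (hN1 : ∀ i, 1 ≤ N i) (hN : ∀ i, N i = M₀ * nC (N i) M₀)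
    (h2 : ∀ i, 2 ≤ nC (N i) M₀) (z : Ctr N M₀) (x x' : TSite d N) :
    |hz118 N M₀ z x - hz118 N M₀ z x'| ≤ d * D1 hprof / M₀ * tdist N x x' := by
  have hM0 : (0 : ℝ) < M₀ := by exact_mod_cast hM
  have hD1 : 0 ≤ D1 hprof := D1_nonneg contDiff_hprof hasCompactSupport_hprof
  have hD1M : 0 ≤ D1 hprof / M₀ := div_nonneg hD1 hM0.le
  unfold hz118 hzR
  calc |∏ i, hper (nC (N i) M₀) (((x i).val : ℝ) / M₀ - ((z i).val : ℝ))
        - ∏ i, hper (nC (N i) M₀) (((x' i).val : ℝ) / M₀ - ((z i).val : ℝ))|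
      ≤ ∑ i, |hper (nC (N i) M₀) (((x i).val : ℝ) / M₀ - ((z i).val : ℝ))
          - hper (nC (N i) M₀) (((x' i).val : ℝ) / M₀ - ((z i).val : ℝ))| :=
        abs_prod_sub_prod_le _ _ _ (fun i _ => ⟨hper_nonneg _ _, hper_le_one _ _⟩)
          fun i _ => ⟨hper_nonneg _ _, hper_le_one _ _⟩
    _ ≤ ∑ _i : Fin d, D1 hprof / M₀ * tdist N x x' := by
        refine Finset.sum_le_sum fun i _ => ?_
        have h := abs_hper_coord_sub_le hM (h2 i) ((z i).val : ℝ) (((x' i).val : ℕ) : ℤ) (((x i).val : ℕ) : ℤ)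
        rw [← hN i] at h
        push_cast at h
        calc _ ≤ D1 hprof / M₀ * (circAbs (N i) (((x i).val : ℤ) - ((x' i).val : ℤ)) : ℝ) := h
          _ ≤ D1 hprof / M₀ * tdist N x x' := mul_le_mul_of_nonneg_left (circAbs_le_tdist hN1 x x' i) hD1M
    _ = d * D1 hprof / M₀ * tdist N x x' := by
        rw [Finset.sum_const, Finset.card_univ, Fintype.card_fin, nsmul_eq_mul]
        ring

variable [∀ i, NeZero (N i)]

/-- **the Lipschitz datum on the metric carrier**: `|h_z(x) − h_z(x′)| ≤ (d·sup|h′|/M₀)·dist x x′` on `UT N` — the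
field `Schema.lip` of `B5Commutator128` for the printed partition. [cite: Balaban1984PropagatorsI, (1.118) p.36 with (1.128) p.38] -/
theorem hz118U_lipschitz {M₀ : ℕ} (hM : 1 ≤ M₀) (hN : ∀ i, N i = M₀ * nC (N i) M₀) (h2 : ∀ i, 2 ≤ nC (N i) M₀)
    (z : Ctr N M₀) (x x' : UT N) :
    |hz118U N M₀ z x - hz118U N M₀ z x'| ≤ d * D1 hprof / M₀ * dist x x' :=
  abs_hz118_sub_le hM (UT.one_le N) hN h2 z _ _

end Lipschitz

/-! ## §2  `Δh_z = O(M₀⁻²)` along the axes of the carrier -/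

section Second

variable {d : ℕ} {N : Fin d → ℕ} [∀ i, NeZero (N i)]

/-- **centred second differences of the printed partition functions are `≤ sup|h″|/M₀²`** along every axis of the
carrier `UT N` (`M₀ ≥ 3`, `N_i = M₀·(N_i/M₀)`, `≥ 2` cubes per direction) — the `(Δh)A` datum of (1.121).
[cite: Balaban1984PropagatorsI, (1.118) p.36 with (1.121) p.37] -/
theorem abs_hz118U_centred_le {M₀ : ℕ} (hM : 3 ≤ M₀) (hN : ∀ i, N i = M₀ * nC (N i) M₀)
    (h2 : ∀ i, 2 ≤ nC (N i) M₀) (z : Ctr N M₀) (x : UT N) (μ : Fin d) :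
    |hz118U N M₀ z (up x μ) - 2 * hz118U N M₀ z x + hz118U N M₀ z (dn x μ)| ≤ D2 hprof / (M₀ : ℝ) ^ 2 := by
  have hM1 : 1 ≤ M₀ := by omega
  set s : TSite d N := UT.toSite N x with hs
  set a : Fin d → ℤ := fun i => ((s i).val : ℤ) with ha
  -- the three lifts
  have hx : hz118U N M₀ z x = hzR (fun i => nC (N i) M₀) M₀ z (fun i => (a i : ℝ)) := by
    unfold hz118U
    exact (hz118_eq_hzR_of_lift hM1 hN z s a fun i => Int.ModEq.refl _).symm
  have hup : hz118U N M₀ z (up x μ)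
      = hzR (fun i => nC (N i) M₀) M₀ z (fun i => ((Function.update a μ (a μ + 1) i : ℤ) : ℝ)) := by
    unfold hz118U
    refine (hz118_eq_hzR_of_lift hM1 hN z (UT.toSite N (up x μ)) (Function.update a μ (a μ + 1)) ?_).symm
    intro i
    by_cases hi : i = μ
    · subst hi
      rw [Function.update_self]
      have e : UT.toSite N (up x i) i = s i + 1 := by
        show Function.update (UT.toSite N x) i (UT.toSite N x i + 1) i = _
        rw [Function.update_self]
      rw [e]
      obtain ⟨m, hm⟩ := fin_val_add_one_rep (s i)
      rw [hm]
      exact Int.modEq_iff_dvd.mpr ⟨m, by simp [ha]⟩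
    · have e : UT.toSite N (up x μ) i = s i := by
        show Function.update (UT.toSite N x) μ (UT.toSite N x μ + 1) i = _
        rw [Function.update_of_ne hi]
      rw [Function.update_of_ne hi, e]
  have hdn : hz118U N M₀ z (dn x μ)
      = hzR (fun i => nC (N i) M₀) M₀ z (fun i => ((Function.update a μ (a μ - 1) i : ℤ) : ℝ)) := by
    unfold hz118U
    refine (hz118_eq_hzR_of_lift hM1 hN z (UT.toSite N (dn x μ)) (Function.update a μ (a μ - 1)) ?_).symm
    intro i
    by_cases hi : i = μ
    · subst hi
      rw [Function.update_self]
      have e : UT.toSite N (dn x i) i = s i - 1 := by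
        show Function.update (UT.toSite N x) i (UT.toSite N x i - 1) i = _
        rw [Function.update_self]
      rw [e]
      obtain ⟨m, hm⟩ := fin_val_add_one_rep (s i - 1)
      rw [sub_add_cancel] at hm
      -- `hm : val (s i) = val (s i - 1) + 1 + N m`
      exact Int.modEq_iff_dvd.mpr ⟨-m, by simp [ha]; linarith⟩
    · have e : UT.toSite N (dn x μ) i = s i := by
        show Function.update (UT.toSite N x) μ (UT.toSite N x μ - 1) i = _
        rw [Function.update_of_ne hi]
      rw [Function.update_of_ne hi, e]
  rw [hup, hx, hdn]
  exact abs_hz118_lift_second_diff_le hM h2 z a μ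

end Second

/-! ## §3  The chain (1.126) ⟹ (1.128) for the printed partition -/

section Chain

variable {ι : Type} [Fintype ι] {d : ℕ} {N : Fin d → ℕ} [∀ i, NeZero (N i)]

/-- **(1.128) for the printed partition, kernel part discharged** — `B5Commutator128.h128_schema` instantiated with
`a z i := h_z(π i)` (support radius `⅔M₀`, Lipschitz constant `d·sup|h′|/M₀`): GIVEN the split
`Δ_a = kerOp l + kerOp k` with `l` of range `ρ` and normed local commutator bound `ℓ₁` ((1.121)) and the decay
(1.126) of `k`, the bound (1.128) holds with rate `twoDelta0 δ M₀` and constant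
`ℓ₁e^{4+ρ/M₀} + (d·sup|h′|/M₀)·C·(24/(eδ))·Λ·e⁷`. [cite: Balaban1984PropagatorsI, (1.128) p.38] -/
theorem h128P_torus {M₀ : ℕ} (hM : 1 ≤ M₀) (hN : ∀ i, N i = M₀ * nC (N i) M₀) (h2 : ∀ i, 2 ≤ nC (N i) M₀)
    (π : ι → UT N) {l k : ι → ι → ℝ} {Dg : Module.End ℝ (EuclideanSpace ℝ ι)} {ℓ₁ ρ C δ Λ : ℝ}
    (range : ∀ i j, ρ < dist (π i) (π j) → l i j = 0)
    (local_norm : ∀ z A, ‖(Hop118 N M₀ π z * kerOp l - kerOp l * Hop118 N M₀ π z) A‖ ≤ ℓ₁ * (‖Dg A‖ + ‖A‖))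
    (hℓ₁ : 0 ≤ ℓ₁) (decay : ∀ i j, |k i j| ≤ C * Real.exp (-(δ * dist (π i) (π j)))) (hC : 0 ≤ C)
    (hδ : 0 < δ) (rowsum : ∀ i, ∑ j, Real.exp (-(δ / 8 * dist (π i) (π j))) ≤ Λ)
    (z₁ z₂ : Ctr N M₀) (A : EuclideanSpace ℝ ι) :
    ‖Hop118 N M₀ π z₁ (Kop (kerOp l + kerOp k) (Hop118 N M₀ π) z₂ A)‖
      ≤ (ℓ₁ * Real.exp (4 + ρ / M₀) + d * D1 hprof / M₀ * C * (24 / (Real.exp 1 * δ)) * Λ * Real.exp 7)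
        * Real.exp (-(twoDelta0 δ M₀ * dist (ctrU N M₀ z₁) (ctrU N M₀ z₂))) * (‖Dg A‖ + ‖A‖) := by
  have hM' : (0 : ℝ) < M₀ := by exact_mod_cast hM
  have hD1 : 0 ≤ D1 hprof := D1_nonneg contDiff_hprof hasCompactSupport_hprof
  have hS : Schema π (fun z i => hz118U N M₀ z (π i)) (ctrU N M₀) l k Dg
      (2 / 3 * M₀) (d * D1 hprof / M₀) ℓ₁ ρ C δ Λ :=
    { abs_le := fun z i => by
        unfold hz118U
        rw [abs_of_nonneg (hz118_nonneg M₀ z _)]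
        exact hz118_le_one M₀ z _
      supp := fun z i hne => by
        by_contra hfar
        apply hne
        unfold hz118U
        apply hz118_eq_zero_of_le hM (UT.one_le N) hN
        rw [not_le] at hfar
        have : dist (π i) (ctrU N M₀ z) = tdist N (UT.toSite N (π i)) (ctr (UT.one_le N) M₀ z) := rfl
        rw [← this]
        linarith
      lip := fun z i j => hz118U_lipschitz hM hN h2 z (π i) (π j)
      lip_nonneg := by positivity
      range := range
      local_norm := local_norm
      loc_nonneg := hℓ₁
      decay := decay
      C_nonneg := hC
      δ_pos := hδ
      rowsum := rowsum }
  exact h128_schema hS hM' (by linarith) z₁ z₂ A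

/-- **(1.128) for the printed partition with the row sum discharged** through a base map with fibres `≤ m`
(`B5Commutator128.rowsum_fibre_le`). [cite: Balaban1984PropagatorsI, (1.128) p.38] -/
theorem h128P_torus_fibre {M₀ : ℕ} (hM : 1 ≤ M₀) (hN : ∀ i, N i = M₀ * nC (N i) M₀) (h2 : ∀ i, 2 ≤ nC (N i) M₀)
    (π : ι → UT N) {m : ℕ} (hm : ∀ y : UT N, ((Finset.univ.filter fun j : ι => π j = y).card : ℝ) ≤ m)
    {l k : ι → ι → ℝ} {Dg : Module.End ℝ (EuclideanSpace ℝ ι)} {ℓ₁ ρ C δ : ℝ}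
    (range : ∀ i j, ρ < dist (π i) (π j) → l i j = 0)
    (local_norm : ∀ z A, ‖(Hop118 N M₀ π z * kerOp l - kerOp l * Hop118 N M₀ π z) A‖ ≤ ℓ₁ * (‖Dg A‖ + ‖A‖))
    (hℓ₁ : 0 ≤ ℓ₁) (decay : ∀ i j, |k i j| ≤ C * Real.exp (-(δ * dist (π i) (π j)))) (hC : 0 ≤ C)
    (hδ : 0 < δ) (z₁ z₂ : Ctr N M₀) (A : EuclideanSpace ℝ ι) :
    ‖Hop118 N M₀ π z₁ (Kop (kerOp l + kerOp k) (Hop118 N M₀ π) z₂ A)‖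
      ≤ (ℓ₁ * Real.exp (4 + ρ / M₀)
          + d * D1 hprof / M₀ * C * (24 / (Real.exp 1 * δ)) * (m * B4Sect5Proof.latticeConst d (δ / 8))
            * Real.exp 7)
        * Real.exp (-(twoDelta0 δ M₀ * dist (ctrU N M₀ z₁) (ctrU N M₀ z₂))) * (‖Dg A‖ + ‖A‖) :=
  h128P_torus hM hN h2 π range local_norm hℓ₁ decay hC hδ
    (fun i => rowsum_fibre_le π hm (by positivity) i) z₁ z₂ A

variable [DecidableEq ι]

/-- **THE LAPLACIAN PART OF (1.121) FOR THE PRINTED PARTITION, PROVED**: for an axis Laplacian `w` through `π` and any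
`Dg` dominating its gradient norm, `‖[h_z, Δ_w]A‖ ≤ ((d·sup|h′|/M₀)√(2d) + d·sup|h″|/M₀²)(‖Dg A‖ + ‖A‖)` — the field
`Schema.local_norm` for `l := lapKer w` with `ℓ₁ = O(M₀⁻¹)` (`M₀ ≥ 3`). [cite: Balaban1984PropagatorsI, (1.121) p.37 with (1.128) p.38] -/
theorem local_norm_lap_h118 {M₀ : ℕ} (hM : 3 ≤ M₀) (hN : ∀ i, N i = M₀ * nC (N i) M₀) (h2 : ∀ i, 2 ≤ nC (N i) M₀)
    {π : ι → UT N} {w : ι → ι → ℝ} (hw : IsAxisLap π w) {Dg : Module.End ℝ (EuclideanSpace ℝ ι)}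
    (hDg : ∀ A, Real.sqrt (dirichlet w A) ≤ ‖Dg A‖) (z : Ctr N M₀) (A : EuclideanSpace ℝ ι) :
    ‖(Hop118 N M₀ π z * kerOp (lapKer w) - kerOp (lapKer w) * Hop118 N M₀ π z) A‖
      ≤ (d * D1 hprof / M₀ * Real.sqrt (2 * d) + d * D2 hprof / (M₀ : ℝ) ^ 2) * (‖Dg A‖ + ‖A‖) := by
  have hM1 : 1 ≤ M₀ := by omega
  have hM0 : (0 : ℝ) < M₀ := by exact_mod_cast hM1
  have hD1 : 0 ≤ D1 hprof := D1_nonneg contDiff_hprof hasCompactSupport_hprof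
  have hD2 : 0 ≤ D2 hprof := D2_nonneg contDiff_hprof hasCompactSupport_hprof
  have hlip : ∀ i j, w i j ≠ 0 → |hz118U N M₀ z (π i) - hz118U N M₀ z (π j)| ≤ d * D1 hprof / M₀ := by
    intro i j hij
    calc |hz118U N M₀ z (π i) - hz118U N M₀ z (π j)| ≤ d * D1 hprof / M₀ * dist (π i) (π j) :=
          hz118U_lipschitz hM1 hN h2 z _ _
      _ ≤ d * D1 hprof / M₀ * 1 := mul_le_mul_of_nonneg_left (hw.range i j hij) (by positivity)
      _ = d * D1 hprof / M₀ := mul_one _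
  have hm : ∀ i, |∑ j, w i j * (hz118U N M₀ z (π j) - hz118U N M₀ z (π i))| ≤ d * D2 hprof / (M₀ : ℝ) ^ 2 := by
    intro i
    rw [hw.axis (hz118U N M₀ z) i]
    calc |∑ μ, (hz118U N M₀ z (up (π i) μ) - 2 * hz118U N M₀ z (π i) + hz118U N M₀ z (dn (π i) μ))|
        ≤ ∑ μ, |hz118U N M₀ z (up (π i) μ) - 2 * hz118U N M₀ z (π i) + hz118U N M₀ z (dn (π i) μ)| :=
          Finset.abs_sum_le_sum_abs _ _
      _ ≤ ∑ _μ : Fin d, D2 hprof / (M₀ : ℝ) ^ 2 :=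
          Finset.sum_le_sum fun μ _ => abs_hz118U_centred_le hM hN h2 z (π i) μ
      _ = d * D2 hprof / (M₀ : ℝ) ^ 2 := by
          rw [Finset.sum_const, Finset.card_univ, Fintype.card_fin, nsmul_eq_mul]; ring
  unfold Hop118
  exact norm_comm_lap_le' hw.nonneg (by positivity) hlip (by positivity) hw.rowsum (by positivity) hm hDg A

/-- **(1.128) for `Δ_a = Δ_w + (local kernel l′) + (decaying kernel k)` with the printed partition**
(`B5Leibniz121.h128_lap_torus` for `Hop118`): the Laplacian commutator proved (`local_norm_lap_h118`), a further local
kernel `l′` of range `ρ ≥ 1` with normed commutator bound `ℓ′` (HYPOTHESIS), the decay (1.126) of `k` (HYPOTHESIS).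
[cite: Balaban1984PropagatorsI, (1.128) p.38 with (1.121) p.37, (1.126) p.38] -/
theorem h128_lap_torus118 {M₀ : ℕ} (hM : 3 ≤ M₀) (hN : ∀ i, N i = M₀ * nC (N i) M₀) (h2 : ∀ i, 2 ≤ nC (N i) M₀)
    (π : ι → UT N) {m : ℕ} (hm : ∀ y : UT N, ((Finset.univ.filter fun j : ι => π j = y).card : ℝ) ≤ m)
    {w : ι → ι → ℝ} (hw : IsAxisLap π w) {Dg : Module.End ℝ (EuclideanSpace ℝ ι)}
    (hDg : ∀ A, Real.sqrt (dirichlet w A) ≤ ‖Dg A‖)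
    {l' k : ι → ι → ℝ} {ℓ' ρ C δ : ℝ} (hρ : 1 ≤ ρ) (range' : ∀ i j, ρ < dist (π i) (π j) → l' i j = 0)
    (local' : ∀ z A, ‖(Hop118 N M₀ π z * kerOp l' - kerOp l' * Hop118 N M₀ π z) A‖ ≤ ℓ' * (‖Dg A‖ + ‖A‖))
    (hℓ' : 0 ≤ ℓ') (decay : ∀ i j, |k i j| ≤ C * Real.exp (-(δ * dist (π i) (π j)))) (hC : 0 ≤ C)
    (hδ : 0 < δ) (z₁ z₂ : Ctr N M₀) (A : EuclideanSpace ℝ ι) :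
    ‖Hop118 N M₀ π z₁ (Kop (kerOp (fun i j => lapKer w i j + l' i j) + kerOp k) (Hop118 N M₀ π) z₂ A)‖
      ≤ (((d * D1 hprof / M₀ * Real.sqrt (2 * d) + d * D2 hprof / (M₀ : ℝ) ^ 2) + ℓ') * Real.exp (4 + ρ / M₀)
          + d * D1 hprof / M₀ * C * (24 / (Real.exp 1 * δ)) * (m * B4Sect5Proof.latticeConst d (δ / 8))
            * Real.exp 7)
        * Real.exp (-(twoDelta0 δ M₀ * dist (ctrU N M₀ z₁) (ctrU N M₀ z₂))) * (‖Dg A‖ + ‖A‖) := by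
  have hM1 : 1 ≤ M₀ := by omega
  have hD1 : 0 ≤ D1 hprof := D1_nonneg contDiff_hprof hasCompactSupport_hprof
  have hD2 : 0 ≤ D2 hprof := D2_nonneg contDiff_hprof hasCompactSupport_hprof
  have range : ∀ i j, ρ < dist (π i) (π j) → lapKer w i j + l' i j = 0 := by
    intro i j hij
    have hne : i ≠ j := by
      rintro rfl
      rw [dist_self] at hij
      linarith
    have hw0 : w i j = 0 := by
      by_contra h
      have := hw.range i j h
      linarith
    rw [range' i j hij, add_zero]
    unfold lapKer
    rw [if_neg hne, hw0, sub_zero]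
  have local_norm : ∀ z A, ‖(Hop118 N M₀ π z * kerOp (fun i j => lapKer w i j + l' i j)
      - kerOp (fun i j => lapKer w i j + l' i j) * Hop118 N M₀ π z) A‖
        ≤ ((d * D1 hprof / M₀ * Real.sqrt (2 * d) + d * D2 hprof / (M₀ : ℝ) ^ 2) + ℓ') * (‖Dg A‖ + ‖A‖) := by
    intro z A
    have h1 := local_norm_lap_h118 hM hN h2 hw hDg z A
    have h2' := local' z A
    unfold Hop118 at h1 h2' ⊢
    rw [comm_kerOp_add, add_mul]
    exact (norm_add_le _ _).trans (add_le_add h1 h2')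
  exact h128P_torus_fibre hM1 hN h2 π hm range local_norm (by positivity) decay hC hδ z₁ z₂ A

omit [DecidableEq ι] in
/-- **the finite-range local bound with the printed partition**: `‖[h_z, kerOp m]A‖ ≤ (d·sup|h′|/M₀)·ρ·R·(‖Dg A‖ + ‖A‖)`
for every finite-range kernel `m` (range `ρ`, absolute row/column sums `≤ R`) — only the Lipschitz datum is consumed
(the `S*(∂h)QA − Q*S(∂h)A` terms of (1.121)). [cite: Balaban1984PropagatorsI, (1.128) p.38 with (1.121) p.37] -/
theorem local_finiteRange_h118' {M₀ : ℕ} (hM : 1 ≤ M₀) (hN : ∀ i, N i = M₀ * nC (N i) M₀)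
    (h2 : ∀ i, 2 ≤ nC (N i) M₀) (π : ι → UT N) {m : ι → ι → ℝ} {ρ R : ℝ}
    (hρ : 0 ≤ ρ) (hR0 : 0 ≤ R) (range : ∀ i j, ρ < dist (π i) (π j) → m i j = 0)
    (hR : ∀ i, ∑ j, |m i j| ≤ R) (hC : ∀ j, ∑ i, |m i j| ≤ R)
    (Dg : Module.End ℝ (EuclideanSpace ℝ ι)) (z : Ctr N M₀) (A : EuclideanSpace ℝ ι) :
    ‖(Hop118 N M₀ π z * kerOp m - kerOp m * Hop118 N M₀ π z) A‖
      ≤ d * D1 hprof / M₀ * ρ * R * (‖Dg A‖ + ‖A‖) := by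
  have hD1 : 0 ≤ D1 hprof := D1_nonneg contDiff_hprof hasCompactSupport_hprof
  have h : ‖(Hop118 N M₀ π z * kerOp m - kerOp m * Hop118 N M₀ π z) A‖ ≤ d * D1 hprof / M₀ * ρ * R * ‖A‖ := by
    unfold Hop118
    exact norm_comm_finiteRange_le π (by positivity) hρ (fun i j => hz118U_lipschitz hM hN h2 z (π i) (π j))
      range hR hC A
  have h0 : (0 : ℝ) ≤ d * D1 hprof / M₀ * ρ * R := by positivity
  have h1 : ‖A‖ ≤ ‖Dg A‖ + ‖A‖ := le_add_of_nonneg_left (norm_nonneg _)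
  exact h.trans (mul_le_mul_of_nonneg_left h1 h0)

/-- **(1.128) for `Δ_a = Δ_w + l′ + k` with the printed partition, `l′` ANY finite-range kernel** (range `ρ ≥ 1`,
absolute row/column sums `≤ R`) — `h128_lap_torus118` with `local′` supplied by `local_finiteRange_h118'`.
[cite: Balaban1984PropagatorsI, (1.128) p.38 with (1.121) p.37, (1.126) p.38] -/
theorem h128_finiteRange_torus118 {M₀ : ℕ} (hM : 3 ≤ M₀) (hN : ∀ i, N i = M₀ * nC (N i) M₀)
    (h2 : ∀ i, 2 ≤ nC (N i) M₀) (π : ι → UT N) {m : ℕ}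
    (hm : ∀ y : UT N, ((Finset.univ.filter fun j : ι => π j = y).card : ℝ) ≤ m)
    {w : ι → ι → ℝ} (hw : IsAxisLap π w) {Dg : Module.End ℝ (EuclideanSpace ℝ ι)}
    (hDg : ∀ A, Real.sqrt (dirichlet w A) ≤ ‖Dg A‖)
    {l' k : ι → ι → ℝ} {ρ R C δ : ℝ} (hρ : 1 ≤ ρ) (range' : ∀ i j, ρ < dist (π i) (π j) → l' i j = 0)
    (hR : ∀ i, ∑ j, |l' i j| ≤ R) (hRc : ∀ j, ∑ i, |l' i j| ≤ R) (hR0 : 0 ≤ R)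
    (decay : ∀ i j, |k i j| ≤ C * Real.exp (-(δ * dist (π i) (π j)))) (hC : 0 ≤ C) (hδ : 0 < δ)
    (z₁ z₂ : Ctr N M₀) (A : EuclideanSpace ℝ ι) :
    ‖Hop118 N M₀ π z₁ (Kop (kerOp (fun i j => lapKer w i j + l' i j) + kerOp k) (Hop118 N M₀ π) z₂ A)‖
      ≤ (((d * D1 hprof / M₀ * Real.sqrt (2 * d) + d * D2 hprof / (M₀ : ℝ) ^ 2) + d * D1 hprof / M₀ * ρ * R)
            * Real.exp (4 + ρ / M₀)
          + d * D1 hprof / M₀ * C * (24 / (Real.exp 1 * δ)) * (m * B4Sect5Proof.latticeConst d (δ / 8))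
            * Real.exp 7)
        * Real.exp (-(twoDelta0 δ M₀ * dist (ctrU N M₀ z₁) (ctrU N M₀ z₂))) * (‖Dg A‖ + ‖A‖) := by
  have hM1 : 1 ≤ M₀ := by omega
  have hD1 : 0 ≤ D1 hprof := D1_nonneg contDiff_hprof hasCompactSupport_hprof
  have hρ0 : (0 : ℝ) ≤ ρ := by linarith
  have local' : ∀ z A, ‖(Hop118 N M₀ π z * kerOp l' - kerOp l' * Hop118 N M₀ π z) A‖
      ≤ d * D1 hprof / M₀ * ρ * R * (‖Dg A‖ + ‖A‖) :=
    fun z A => local_finiteRange_h118' hM1 hN h2 π hρ0 hR0 range' hR hRc Dg z A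
  exact h128_lap_torus118 hM hN h2 π hm hw hDg hρ range' local' (by positivity) decay hC hδ z₁ z₂ A

variable {κ : Type} [Fintype κ]

/-- **(1.128) for `Δ_model = kerOp (lapKer w + a·gram120 τ q) + kerOp k` with the printed partition** — the term
`aQ*Q` of `Δ_a = Δ − ∂P∂* + aQ*Q` as the finite-range part (`B5Averaging120.h128_gram_torus` for `Hop118`).
[cite: Balaban1984PropagatorsI, (1.128) p.38 with (1.121) p.37 (the terms S*(∂h)QA − Q*S(∂h)A), (1.126) p.38] -/
theorem h128_gram_torus118 {M₀ : ℕ} (hM : 3 ≤ M₀) (hN : ∀ i, N i = M₀ * nC (N i) M₀)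
    (h2 : ∀ i, 2 ≤ nC (N i) M₀) (π : ι → UT N) {m : ℕ}
    (hm : ∀ y : UT N, ((Finset.univ.filter fun j : ι => π j = y).card : ℝ) ≤ m)
    {w : ι → ι → ℝ} (hw : IsAxisLap π w) {Dg : Module.End ℝ (EuclideanSpace ℝ ι)}
    (hDg : ∀ A, Real.sqrt (dirichlet w A) ≤ ‖Dg A‖)
    (σ : κ → UT N) {q : κ → ι → ℝ} {r τ Ccol Rrow : ℝ} (a : ℝ) (hr : 1 ≤ 2 * r) (hτ : 0 ≤ τ)
    (hRrow : 0 ≤ Rrow) (hCcol : 0 ≤ Ccol) (supp : ∀ c i, q c i ≠ 0 → dist (σ c) (π i) ≤ r)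
    (col : ∀ i, ∑ c, |q c i| ≤ Ccol) (row : ∀ c, ∑ j, |q c j| ≤ Rrow)
    {k : ι → ι → ℝ} {C δ : ℝ} (decay : ∀ i j, |k i j| ≤ C * Real.exp (-(δ * dist (π i) (π j))))
    (hC : 0 ≤ C) (hδ : 0 < δ) (z₁ z₂ : Ctr N M₀) (A : EuclideanSpace ℝ ι) :
    ‖Hop118 N M₀ π z₁ (Kop (kerOp (fun i j => lapKer w i j + a * gram120 τ q i j) + kerOp k)
        (Hop118 N M₀ π) z₂ A)‖
      ≤ (((d * D1 hprof / M₀ * Real.sqrt (2 * d) + d * D2 hprof / (M₀ : ℝ) ^ 2)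
              + d * D1 hprof / M₀ * (2 * r) * (|a| * (τ * Ccol * Rrow))) * Real.exp (4 + 2 * r / M₀)
          + d * D1 hprof / M₀ * C * (24 / (Real.exp 1 * δ)) * (m * B4Sect5Proof.latticeConst d (δ / 8))
            * Real.exp 7)
        * Real.exp (-(twoDelta0 δ M₀ * dist (ctrU N M₀ z₁) (ctrU N M₀ z₂))) * (‖Dg A‖ + ‖A‖) := by
  have range' : ∀ i j, 2 * r < dist (π i) (π j) → a * gram120 τ q i j = 0 := fun i j hij => by
    rw [gram120_eq_zero_of_far σ π τ supp hij, mul_zero]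
  exact h128_finiteRange_torus118 hM hN h2 π hm hw hDg hr range'
    (smul_gram120_rowsum_le a hτ hRrow col row) (smul_gram120_colsum_le a hτ hRrow col row)
    (by positivity) decay hC hδ z₁ z₂ A

end Chain

/-! ## §4  Bałaban's `Q_k` on vector fields; the field `h128` of `B5Local114.Realisation` for the printed partition -/

section Balaban

variable {d : ℕ} {N : Fin d → ℕ} [∀ i, NeZero (N i)]

/-- **(1.128) FOR `Δ_model = kerOp (lapKer axisWC + a·gram120 (n^d) (avgKer n)) + kerOp k` ON VECTOR FIELDS OVER THE
TORUS WITH THE PRINTED PARTITION, all structural hypotheses discharged** (`B5AveragingTorus.h128_balaban_torus` for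
`Hop118`): componentwise axis Laplacian, Bałaban's averaging kernel `Q_k` (block side `n ≥ 1`, full block on every
axis), cube size `M₀ ≥ 3` in fine steps with `M₀ ∣ N_i`, `≥ 2` cubes per direction, and ANY kernel `k` with the decay
(1.126) (HYPOTHESIS, B4 territory). [cite: Balaban1984PropagatorsI, (1.128) p.38 with (1.121) p.37, (1.18) p.20, (1.126) p.38] -/
theorem h128_balaban_torus118 {M₀ n : ℕ} (hM : 3 ≤ M₀) (hN : ∀ i, N i = M₀ * nC (N i) M₀)
    (h2 : ∀ i, 2 ≤ nC (N i) M₀) (hn : 1 ≤ n) (hq : ∀ i, 1 ≤ N i / n)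
    {Dg : Module.End ℝ (EuclideanSpace ℝ (UT N × Fin d))}
    (hDg : ∀ A, Real.sqrt (dirichlet (axisWC (N := N) (κ := Fin d)) A) ≤ ‖Dg A‖) (a : ℝ)
    {k : UT N × Fin d → UT N × Fin d → ℝ} {C δ : ℝ}
    (decay : ∀ i j, |k i j| ≤ C * Real.exp (-(δ * dist i.1 j.1))) (hC : 0 ≤ C) (hδ : 0 < δ)
    (z₁ z₂ : Ctr N M₀) (A : EuclideanSpace ℝ (UT N × Fin d)) :
    ‖Hop118 N M₀ (fun p : UT N × Fin d => p.1) z₁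
        (Kop (kerOp (fun i j => lapKer axisWC i j + a * gram120 ((n : ℝ) ^ d) (avgKer n) i j) + kerOp k)
          (Hop118 N M₀ fun p : UT N × Fin d => p.1) z₂ A)‖
      ≤ (((d * D1 hprof / M₀ * Real.sqrt (2 * d) + d * D2 hprof / (M₀ : ℝ) ^ 2)
              + d * D1 hprof / M₀ * (4 * n) * |a|) * Real.exp (4 + 4 * n / M₀)
          + d * D1 hprof / M₀ * C * (24 / (Real.exp 1 * δ)) * (d * B4Sect5Proof.latticeConst d (δ / 8))
            * Real.exp 7)
        * Real.exp (-(twoDelta0 δ M₀ * dist (ctrU N M₀ z₁) (ctrU N M₀ z₂))) * (‖Dg A‖ + ‖A‖) := by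
  classical
  have hn0 : (0 : ℝ) < n := by exact_mod_cast hn
  have hr : (1 : ℝ) ≤ 2 * (2 * (n : ℝ)) := by
    have : (1 : ℝ) ≤ n := by exact_mod_cast hn
    linarith
  have h := h128_gram_torus118 (N := N) (ι := UT N × Fin d) (κ := Ctr N n × Fin d) hM hN h2
    (fun p : UT N × Fin d => p.1) (m := d) fibre_card_fst isAxisLap_prod hDg
    (fun c : Ctr N n × Fin d => ctrU N n c.1) (q := avgKer n) (r := 2 * (n : ℝ)) (τ := (n : ℝ) ^ d)
    (Ccol := 1 / (n : ℝ) ^ d) (Rrow := 1) a hr (by positivity) zero_le_one (by positivity)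
    (fun c i hci => dist_le_of_avgKer_ne_zero n c i hci) (avgKer_colsum_le hn hq)
    (avgKer_abs_rowsum_le hn) decay hC hδ z₁ z₂ A
  have e1 : |a| * ((n : ℝ) ^ d * (1 / (n : ℝ) ^ d) * 1) = |a| := by
    field_simp
  have e2 : 2 * (2 * (n : ℝ)) = 4 * n := by ring
  rw [e1, e2] at h
  exact h

/-- MODEL: the constant of `h128_balaban_torus118` as a function of the decay data `(δ, C)` of `k`.
(plumbing of the printed torus partition) [cite: Balaban1984PropagatorsI, (1.128) p.38] -/
def const128P (d M₀ n : ℕ) (a δ C : ℝ) : ℝ :=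
  ((d * D1 hprof / M₀ * Real.sqrt (2 * d) + d * D2 hprof / (M₀ : ℝ) ^ 2) + d * D1 hprof / M₀ * (4 * n) * |a|)
      * Real.exp (4 + 4 * n / M₀)
    + d * D1 hprof / M₀ * C * (24 / (Real.exp 1 * δ)) * (d * B4Sect5Proof.latticeConst d (δ / 8)) * Real.exp 7

/-- MODEL: the (1.128) constant function `θ̄(δ₀′, C)` for the printed partition: `M₀ · const128P`, clipped below at `0`
(so that it fits `B5Local114.Consts.thetaBar_nonneg` for all arguments). (plumbing of the printed torus partition)
[cite: Balaban1984PropagatorsI, (1.128) p.38] -/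
def thetaBar128P (d M₀ n : ℕ) (a : ℝ) (δ C : ℝ) : ℝ := max ((M₀ : ℝ) * const128P d M₀ n a δ C) 0

/-- `θ̄ ≥ 0` for all arguments. (plumbing of the printed torus partition) [cite: Balaban1984PropagatorsI, (1.128) p.38] -/
theorem thetaBar128P_nonneg (d M₀ n : ℕ) (a δ C : ℝ) : 0 ≤ thetaBar128P d M₀ n a δ C := le_max_right _ _

/-- `θ̄/M₀` dominates the constant of `h128_balaban_torus118` (for `M₀ ≥ 1`). (plumbing of the printed torus
partition) [cite: Balaban1984PropagatorsI, (1.128) p.38] -/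
theorem const128P_le_thetaBar128P_div {M₀ : ℕ} (hM : 1 ≤ M₀) (d n : ℕ) (a δ C : ℝ) :
    const128P d M₀ n a δ C ≤ thetaBar128P d M₀ n a δ C / M₀ := by
  have hM0 : (0 : ℝ) < M₀ := by exact_mod_cast hM
  rw [le_div_iff₀ hM0, thetaBar128P, mul_comm]
  exact le_max_left _ _

/-- **THE TORUS MODEL WITH THE PRINTED PARTITION SUPPLIES `Realisation.h128`**: for every kernel `k`, the predicate
`B5Realisation128.H128Shape` holds for the data (`kernelData N k`, `M₀`, `thetaBar128P d M₀ n a`,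
`Hop118 N M₀ (·.1)`, `deltaA n a k`, `Dg`, `ctrU`) — i.e. (1.126) for `k` with ANY constants `δ₀′, C > 0` implies
(1.128) with `θ̄(δ₀′,C)/M₀` and `2δ₀ = twoDelta0 δ₀′ M₀`, uniformly in the volume.  Standing structural hypotheses:
`3 ≤ M₀`, `N_i = M₀·(N_i/M₀)`, `2 ≤ N_i/M₀`, `1 ≤ n`, `1 ≤ N_i/n`, and a gradient operator `Dg` dominating
`√(dirichlet axisWC ·)`. [cite: Balaban1984PropagatorsI, (1.128) p.38] -/
theorem h128Shape_torus118 {M₀ n : ℕ} (hM : 3 ≤ M₀) (hN : ∀ i, N i = M₀ * nC (N i) M₀) (h2 : ∀ i, 2 ≤ nC (N i) M₀)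
    (hn : 1 ≤ n) (hq : ∀ i, 1 ≤ N i / n) {Dg : Module.End ℝ (EuclideanSpace ℝ (UT N × Fin d))}
    (hDg : ∀ A, Real.sqrt (dirichlet (axisWC (N := N) (κ := Fin d)) A) ≤ ‖Dg A‖) (a : ℝ)
    (k : UT N × Fin d → UT N × Fin d → ℝ) :
    H128Shape (kernelData N k) M₀ (thetaBar128P d M₀ n a) (Hop118 N M₀ fun p : UT N × Fin d => p.1)
      (deltaA n a k) Dg (ctrU N M₀) := by
  have hM1 : 1 ≤ M₀ := by omega
  intro δ₀' C hδ hC hker z₁ z₂ A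
  have h := h128_balaban_torus118 hM hN h2 hn hq hDg a (k := k) (C := C) (δ := δ₀') hker hC.le hδ z₁ z₂ A
  refine h.trans ?_
  have hE : 0 ≤ Real.exp (-(twoDelta0 δ₀' M₀ * dist (ctrU N M₀ z₁) (ctrU N M₀ z₂))) * (‖Dg A‖ + ‖A‖) := by
    positivity
  have hle : const128P d M₀ n a δ₀' C ≤ thetaBar128P d M₀ n a δ₀' C / M₀ :=
    const128P_le_thetaBar128P_div hM1 d n a δ₀' C
  have key := mul_le_mul_of_nonneg_right hle hE
  simpa only [const128P, mul_assoc] using key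

end Balaban

end

end Literature.MathematicalPhysics.QuantumFieldTheory.Balaban1983to89.B5Partition118H128
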